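import Literature.NumberTheory.Transcendental.RoySmallValuePhiMult
import Literature.NumberTheory.Transcendental.RoySmallValueSelectionLemma
import Literature.NumberTheory.Transcendental.RoySmallValueEstimatesClosestPointProofs
import HarnessLib

/-!
# Small value estimates at rational translates (Nguyen–Roy 2016) — proofs: `Φ` along `(I_D^{(T)})³` and the bound for `h_𝒞(ℙ²)` (Prop. 15, first half)

Proofs file towards `Literature.NumberTheory.Transcendental.nguyenRoy2016_thm_1` (Nguyen–Roy,
*A small value estimate in dimension two involving translations by rational points*, IJNT 12 (2016)
= arXiv:1412.5163, Theorem 1). Everything here is PROVED; three definitions with bodies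
(`transVanIdeal`, `eMat`, `interpConst`), no named facts.

The first half of the proof of **Proposition 15** (§5) reads: *"Since the polynomials of
`I^{(T)}` vanish at each point `(1, γ)` with `γ ∈ Σ = {(ξ + ir, ηsⁱ) ; 0 ≤ i < T}`, the resultant
`Res_D : ℂ[X]_D³ → ℂ` vanishes up to order `T` at each triple of elements of `I_D^{(T)}`. We then
argue as in the proof of [R2012, Prop. 6.1] using `Y = 2D^β` and `U = (1/2)D^ν` and replacing
everywhere the differential operator `𝒟` with the translation morphism `Φ`. We also use our
interpolation result, Proposition 8, in replacement of [R2012, Prop. 3.3]. Then … we obtain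
`h_{𝒞_D}(ℙ²(ℂ)) ≤ −TU + 3YD² + 21 log(3) D³`."* This file proves exactly that, in the
elimination-free form in which the tree formalises [R2012] (seat-B files `RoySmallValue*`: the
determinant `Φ = Roy2013.royPhi` of the proof of Theorem 5.2 replaces `Res_D` throughout, cf.
`Roy2013.royPhi_line_multiplicity`, `Roy2013.prop_6_1`):

* `transVanIdeal ξ η r s T` — the ideal of `F ∈ ℂ[X]` with `F(1, ξ + ir, ηsⁱ) = 0` for
  `0 ≤ i < T` (its forms of degree `D` are `I_D^{(T)}`); `eMat` — the `T` evaluation functionals at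
  `γ̲₀, …, γ̲_{T−1}` on `ℂ[X]_{3D}` in monomial coordinates; they are independent for
  `T ≤ binom(3D+2, 2)` (`exists_rightInverse_eMat`, right inverse from the interpolating basis of
  **Proposition 8**, the tree's `NguyenRoy.exists_dual_basis`, `|s| > 1`) and kill the columns
  `X^μ Qᵢ` of `M_Q` for `Q ∈ (I^{(T)})³` (`eMat_mul_royMatrix`);
* `royPhi_line_multiplicity_translates` — **`Φ` vanishes to order `T` at each triple of elements of
  `I_D^{(T)}`** (along every line: `t^T ∣ Φ(Q + tR)`), the translation analogue of
  [R2012, Cor. 5.7] obtained in the paper from [R2012, Thm. 5.6] with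
  `Σ₁ = {(ir, sⁱ) ; 0 ≤ i ≤ D}`; here directly from the tree's `Roy2013.X_pow_card_dvd_det_line`;
* `exists_form_with_values` — a form of degree `L` with prescribed values at
  `γ̲₀, …, γ̲_{M−1}`, `M = binom(L+2, 2)`, of length `≤ c^{(L+1)³} · max|values|`
  (Proposition 8 in the tree's crude form `NguyenRoy.l1Norm_le_pow_mul_of_eval_translates`,
  constant `interpConst`);
* `royPhi_le_of_small_at_translates` — **the bound for `h_{𝒞_D}(ℙ²)`**: if
  `P₀, P₁, P₂ ∈ ℂ[X]_D` have `‖Pⱼ‖ ≤ e^Y` and `|Pⱼ(γ̲ᵢ)| ≤ e^{−U}` for `0 ≤ i < T` (`Pⱼ ∈ 𝒞`), with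
  `T ≤ binom(L+2, 2)`, `L ≤ D`, `U ≥ 0` and `interpConst^{} ≤ e^Y`, then
  `|Φ(P₀, P₁, P₂)| ≤ e^{−TU} · N! (3e^Y)^N`, `N = binom(3D+2, 2)` — word for word the tree's
  `Roy2013.prop_6_1` with `𝒟ⁱP(1, γ)` replaced by `P(γ̲ᵢ)` (interpolate the first `T` values by
  `Qⱼ ∈ ℂ[X]_L`, so that `Pⱼ − X₀^{D−L}Qⱼ ∈ I^{(T)}`; Schwarz's lemma on
  `z ↦ Φ(Pⱼ − (1 − z)X₀^{D−L}Qⱼ)`, the tree's `Roy2013.norm_eval_one_le_of_X_pow_dvd`; size on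
  `|z| = e^U` by `Roy2013.norm_royPhi_le`).

## References

* [NguyenRoy2016] N. A. V. Nguyen, D. Roy, IJNT 12 (2016) 1273–1293 = arXiv:1412.5163, §3
  Proposition 8, §5 Proposition 15 (first half of the proof) and the convex body `𝒞_D`.
* [Roy2013] D. Roy, Mathematika 59 (2013) = arXiv:1301.0663 ("[R2012]" in the paper), Thm. 5.2,
  Cor. 5.7, Prop. 6.1.
-/

noncomputable section

open MvPolynomial Finset Matrix

namespace Literature.NumberTheory.Transcendental

namespace NguyenRoy

open Roy2013 (CX royPhi royMatrix royMatrix_apply colExp colBlock combo isHomogeneous_combo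
  sum_row_coeff_smul_monomial reindex_royMatrix_line eval_det_line X_pow_card_dvd_det_line
  norm_royPhi_le norm_eval_one_le_of_X_pow_dvd l1Norm_X_pow_mul_le)
open Nesterenko

variable {ξ η r s : ℂ} {D : ℕ} {M₁ M₂ : Finset (Fin 3 →₀ ℕ)}

/-! ### The ideal `I^{(T)}` of polynomials vanishing at `γ̲₀, …, γ̲_{T−1}` -/

variable (ξ η r s) in
/-- The ideal of all `F ∈ ℂ[X₀, X₁, X₂]` with `F(1, ξ + ir, ηsⁱ) = 0` for `0 ≤ i < T`; its forms of
degree `D` constitute `I_D^{(T)}`. [cite: NguyenRoy2016, §3 (the ideal I^{(T)}) and §5] -/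
def transVanIdeal (T : ℕ) : Ideal CX where
  carrier := {F | ∀ i : ℕ, i < T → MvPolynomial.eval ![1, ξ + i * r, η * s ^ i] F = 0}
  zero_mem' := fun i _ => by rw [map_zero]
  add_mem' := fun {F G} hF hG i hi => by rw [map_add, hF i hi, hG i hi, add_zero]
  smul_mem' := fun F {G} hG i hi => by rw [smul_eq_mul, map_mul, hG i hi, mul_zero]

/-- Membership in `transVanIdeal`. [cite: NguyenRoy2016, §3] -/
theorem mem_transVanIdeal_iff {T : ℕ} {F : CX} :
    F ∈ transVanIdeal ξ η r s T ↔
      ∀ i : ℕ, i < T → MvPolynomial.eval ![1, ξ + i * r, η * s ^ i] F = 0 := Iff.rfl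

/-- `(X₀^m F)(1, a, b) = F(1, a, b)`. [folklore] -/
theorem eval_X_zero_pow_mul (a b : ℂ) (m : ℕ) (F : CX) :
    MvPolynomial.eval ![1, a, b] (X 0 ^ m * F) = MvPolynomial.eval ![1, a, b] F := by
  rw [map_mul, map_pow, eval_X, Matrix.cons_val_zero, one_pow, one_mul]

/-- Evaluating a combination of monomials. [folklore] -/
theorem eval_sum_smul_monomial (x : Fin 3 → ℂ)
    (c : ↥(finsuppAntidiag (univ : Finset (Fin 3)) (3 * D)) → ℂ) :
    MvPolynomial.eval x (∑ e, c e • monomial e.1 (1 : ℂ)) =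
      ∑ e, c e * MvPolynomial.eval x (monomial e.1 (1 : ℂ)) := by
  rw [map_sum]
  exact Finset.sum_congr rfl fun e _ => by rw [smul_eq_C_mul, map_mul, eval_C]

/-- `binom(n+2, 2) = (n+1)(n+2)/2`. [folklore] -/
theorem choose_two_eq (n : ℕ) : (n + 2).choose 2 = (n + 1) * (n + 2) / 2 := by
  rw [Nat.choose_two_right, show n + 2 - 1 = n + 1 by omega, mul_comm]

/-! ### The evaluation functionals on `ℂ[X]_{3D}` -/

variable (ξ η r s) in
/-- The `T × binom(3D+2,2)` matrix of the functionals `F ↦ F(γ̲ₖ)` (`k < T`) in the monomial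
coordinates of `ℂ[X]_{3D}`. [cite: NguyenRoy2016, §5, proof of Proposition 15] -/
def eMat (D T : ℕ) : Matrix (Fin T) ↥(finsuppAntidiag (univ : Finset (Fin 3)) (3 * D)) ℂ :=
  Matrix.of fun k e => MvPolynomial.eval ![1, ξ + (k : ℕ) * r, η * s ^ (k : ℕ)] (monomial e.1 (1 : ℂ))

/-- **The evaluation functionals are independent**: `eMat` has a right inverse when
`T ≤ binom(3D+2, 2)` (the interpolating basis of Proposition 8 at `L = 3D`, `|s| > 1`).
[cite: NguyenRoy2016, Proposition 8 and §5, proof of Proposition 15] -/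
theorem exists_rightInverse_eMat (hr : r ≠ 0) (hη : η ≠ 0) (hs : 1 < ‖s‖) {T : ℕ}
    (hT : T ≤ (3 * D + 2).choose 2) :
    ∃ N : Matrix ↥(finsuppAntidiag (univ : Finset (Fin 3)) (3 * D)) (Fin T) ℂ,
      eMat ξ η r s D T * N = 1 := by
  classical
  have hM : (3 * D + 2).choose 2 = (3 * D + 1) * (3 * D + 2) / 2 := choose_two_eq (3 * D)
  have hF : ∀ k : Fin T, ∃ F : CX, F.IsHomogeneous (3 * D) ∧
      ∀ i : ℕ, i < (3 * D + 1) * (3 * D + 2) / 2 →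
        MvPolynomial.eval ![1, ξ + i * r, η * s ^ i] F = if i = k.1 then 1 else 0 := by
    intro k
    obtain ⟨Q, hQh, hQv, -⟩ := exists_dual_basis (ξ := ξ) hr hη hs (3 * D) k.1
      (by rw [← hM]; exact lt_of_lt_of_le k.2 hT)
    exact ⟨Q, hQh, hQv⟩
  choose F hFh hFv using hF
  refine ⟨Matrix.of fun e k => coeff e.1 (F k), ?_⟩
  ext k k'
  rw [Matrix.mul_apply, Matrix.one_apply]
  calc ∑ e, eMat ξ η r s D T k e * (Matrix.of fun e k => coeff e.1 (F k)) e k'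
      = ∑ e, coeff e.1 (F k') *
          MvPolynomial.eval ![1, ξ + (k : ℕ) * r, η * s ^ (k : ℕ)] (monomial e.1 (1 : ℂ)) :=
        Finset.sum_congr rfl fun e _ => by rw [eMat, Matrix.of_apply, Matrix.of_apply, mul_comm]
    _ = MvPolynomial.eval ![1, ξ + (k : ℕ) * r, η * s ^ (k : ℕ)] (F k') := by
        rw [← eval_sum_smul_monomial, sum_row_coeff_smul_monomial (hFh k')]
    _ = if k = k' then 1 else 0 := by
        rw [hFv k' k.1 (by rw [← hM]; exact lt_of_lt_of_le k.2 hT)]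
        simp only [Fin.ext_iff]

/-- **The functionals kill the columns of `M_Q` for `Q ∈ (I^{(T)})³`**: `eMat · M_Q = 0`.
[cite: NguyenRoy2016, §5, proof of Proposition 15] -/
theorem eMat_mul_royMatrix {T : ℕ} (hM₁ : ∀ μ ∈ M₁, μ.degree = 2 * D)
    (hM₂ : ∀ μ ∈ M₂, μ.degree = 2 * D) {Qs : Fin 3 → CX} (hQh : ∀ i, (Qs i).IsHomogeneous D)
    (hQv : ∀ i, Qs i ∈ transVanIdeal ξ η r s T) :
    eMat ξ η r s D T * royMatrix D M₁ M₂ Qs = 0 := by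
  ext k c
  rw [Matrix.mul_apply, Matrix.zero_apply]
  have hcol : (monomial (colExp c) (1 : ℂ) * Qs (colBlock c)).IsHomogeneous (3 * D) := by
    have h := isHomogeneous_combo (M₁ := M₁) (M₂ := M₂) hQh hM₁ hM₂ (Pi.single c 1)
    rwa [combo, Finset.sum_eq_single c (fun c' _ hc' => by rw [Pi.single_eq_of_ne hc', zero_smul])
      (fun h => absurd (Finset.mem_univ c) h), Pi.single_eq_same, one_smul] at h
  calc ∑ e, eMat ξ η r s D T k e * royMatrix D M₁ M₂ Qs e c
      = ∑ e, coeff e.1 (monomial (colExp c) (1 : ℂ) * Qs (colBlock c)) *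
          MvPolynomial.eval ![1, ξ + (k : ℕ) * r, η * s ^ (k : ℕ)] (monomial e.1 (1 : ℂ)) :=
        Finset.sum_congr rfl fun e _ => by rw [eMat, Matrix.of_apply, royMatrix_apply, mul_comm]
    _ = MvPolynomial.eval ![1, ξ + (k : ℕ) * r, η * s ^ (k : ℕ)]
          (monomial (colExp c) (1 : ℂ) * Qs (colBlock c)) := by
        rw [← eval_sum_smul_monomial, sum_row_coeff_smul_monomial hcol]
    _ = 0 := (Ideal.mul_mem_left _ _ (hQv (colBlock c))) k.1 k.2

/-- **`Φ` vanishes to order `T` at each triple of elements of `I_D^{(T)}`** (along lines): for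
`r ≠ 0`, `η ≠ 0`, `|s| > 1`, `T ≤ binom(3D+2, 2)`, `Q₀, Q₁, Q₂ ∈ ℂ[X]_D ∩ I^{(T)}` and any
`R ∈ ℂ[X]³`, `t ↦ Φ(Q + tR)` is a polynomial divisible by `t^T`. (Printed for `Res_D`, from
[R2012, Thm. 5.6]; here for the determinant `Φ` of the proof of [R2012, Thm. 5.2].)
[cite: NguyenRoy2016, §5, proof of Proposition 15 ("Res_D … vanishes up to order T at each triple of elements of I_D^{(T)}")] -/
theorem royPhi_line_multiplicity_translates (hr : r ≠ 0) (hη : η ≠ 0) (hs : 1 < ‖s‖) {T : ℕ}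
    (hT : T ≤ (3 * D + 2).choose 2)
    (hM₁ : ∀ μ ∈ M₁, μ.degree = 2 * D) (hM₂ : ∀ μ ∈ M₂, μ.degree = 2 * D)
    (σ : (↥(finsuppAntidiag (univ : Finset (Fin 3)) (2 * D)) ⊕ (↥M₁ ⊕ ↥M₂)) ≃
      ↥(finsuppAntidiag (univ : Finset (Fin 3)) (3 * D)))
    {Qs : Fin 3 → CX} (hQh : ∀ i, (Qs i).IsHomogeneous D)
    (hQv : ∀ i, Qs i ∈ transVanIdeal ξ η r s T) (Rs : Fin 3 → CX) :
    ∃ p : Polynomial ℂ, (Polynomial.X : Polynomial ℂ) ^ T ∣ p ∧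
      ∀ t : ℂ, royPhi D M₁ M₂ σ (Qs + t • Rs) = p.eval t := by
  classical
  obtain ⟨N, hN⟩ := exists_rightInverse_eMat (D := D) hr hη hs hT
  set A : Matrix _ _ ℂ := (royMatrix D M₁ M₂ Qs).reindex (Equiv.refl _) σ with hA
  set B : Matrix _ _ ℂ := (royMatrix D M₁ M₂ Rs).reindex (Equiv.refl _) σ with hB
  have hLA : eMat ξ η r s D T * A = 0 := by
    rw [hA]
    ext k j
    rw [Matrix.mul_apply, Matrix.zero_apply]
    have h := congr_fun (congr_fun (eMat_mul_royMatrix (T := T) hM₁ hM₂ hQh hQv) k) (σ.symm j)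
    rw [Matrix.mul_apply, Matrix.zero_apply] at h
    rw [← h]
    exact Finset.sum_congr rfl fun e _ => by simp [Matrix.reindex_apply, Matrix.submatrix_apply]
  have hdvd := X_pow_card_dvd_det_line (eMat ξ η r s D T) N hN A B hLA
  rw [Fintype.card_fin] at hdvd
  refine ⟨_, hdvd, fun t => ?_⟩
  rw [royPhi, reindex_royMatrix_line, eval_det_line]

/-! ### Interpolation at the translates (Proposition 8) -/

variable (ξ η r s) in
/-- The constant `c^{(L+1)³}` of the crude form of Proposition 8 (`NguyenRoy.exists_dual_basis`,
`NguyenRoy.l1Norm_le_pow_mul_of_eval_translates`), `c = 16 c₁ |s| min(1, |s|−1)⁻²`,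
`c₁ = max(1,|η|⁻¹)(1+|ξ|)max(1,|r|⁻¹)`. [cite: NguyenRoy2016, Proposition 8 (the constant c₂) and the remark on p. 6 that a cruder estimate suffices] -/
def interpConst (L : ℕ) : ℝ :=
  (16 * (max 1 ‖η‖⁻¹ * (1 + ‖ξ‖) * max 1 ‖r‖⁻¹) * ‖s‖ * (min 1 (‖s‖ - 1))⁻¹ ^ 2) ^ ((L + 1) ^ 3)

/-- `interpConst ≥ 0`. [folklore] -/
theorem interpConst_nonneg (L : ℕ) : 0 ≤ interpConst ξ η r s L := by
  unfold interpConst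
  positivity

/-- **A form of degree `L` with prescribed values at `γ̲₀, …, γ̲_{M−1}`**, `M = binom(L+2, 2)`, of
length at most `interpConst · B` when the values are bounded by `B` (`r ≠ 0`, `η ≠ 0`, `|s| > 1`).
[cite: NguyenRoy2016, Proposition 8] -/
theorem exists_form_with_values (hr : r ≠ 0) (hη : η ≠ 0) (hs : 1 < ‖s‖) (L : ℕ) (v : ℕ → ℂ)
    {B : ℝ} (hv : ∀ i : ℕ, i < (L + 1) * (L + 2) / 2 → ‖v i‖ ≤ B) :
    ∃ Q : CX, Q.IsHomogeneous L ∧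
      (∀ i : ℕ, i < (L + 1) * (L + 2) / 2 →
        MvPolynomial.eval ![1, ξ + i * r, η * s ^ i] Q = v i) ∧
      l1Norm Q ≤ interpConst ξ η r s L * B := by
  classical
  set M := (L + 1) * (L + 2) / 2 with hM
  have hb : ∀ j : Fin M, ∃ Q : CX, Q.IsHomogeneous L ∧
      ∀ i : ℕ, i < M → MvPolynomial.eval ![1, ξ + i * r, η * s ^ i] Q = if i = j.1 then 1 else 0 := by
    intro j
    obtain ⟨Q, hQh, hQv, -⟩ := exists_dual_basis (ξ := ξ) hr hη hs L j.1 j.2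
    exact ⟨Q, hQh, hQv⟩
  choose b hbh hbv using hb
  set Q : CX := ∑ j : Fin M, v j.1 • b j with hQ
  have hQh : Q.IsHomogeneous L := by
    rw [hQ]
    refine IsHomogeneous.sum _ _ _ fun j _ => ?_
    exact (homogeneousSubmodule (Fin 3) ℂ L).smul_mem (v j.1) (hbh j)
  have hQv : ∀ i : ℕ, i < M → MvPolynomial.eval ![1, ξ + i * r, η * s ^ i] Q = v i := by
    intro i hi
    rw [hQ, map_sum]
    simp_rw [smul_eq_C_mul, map_mul, eval_C]
    rw [Finset.sum_eq_single (⟨i, hi⟩ : Fin M)]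
    · rw [hbv ⟨i, hi⟩ i hi, if_pos rfl, mul_one]
    · intro j _ hj
      rw [hbv j i hi, if_neg (fun h => hj (Fin.ext h.symm)), mul_zero]
    · intro h
      exact absurd (Finset.mem_univ _) h
  refine ⟨Q, hQh, hQv, ?_⟩
  have h := l1Norm_le_pow_mul_of_eval_translates hr hη hs hQh (B := B) fun i hi => by
    rw [hQv i hi]; exact hv i hi
  exact h

/-! ### The bound for `h_{𝒞_D}(ℙ²)` (Proposition 15, first half) -/

/-- **Nguyen–Roy 2016, proof of Proposition 15, first half** (the translation analogue of
[R2012, Prop. 6.1], for `Φ`). Let `r ≠ 0`, `η ≠ 0`, `|s| > 1`, `T ≤ binom(L+2, 2)`, `L ≤ D`,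
`U ≥ 0` and `interpConst(L) ≤ e^Y`. If `P₀, P₁, P₂ ∈ ℂ[X]_D` satisfy `‖Pⱼ‖ ≤ e^Y` and
`|Pⱼ(1, ξ + ir, ηsⁱ)| ≤ e^{−U}` for `0 ≤ i < T` (i.e. `Pⱼ ∈ 𝒞`), then
`|Φ(P₀, P₁, P₂)| ≤ e^{−TU} · N! · (3e^Y)^N` with `N = binom(3D+2, 2)`. (Printed:
`h_{𝒞_D}(ℙ²(ℂ)) ≤ −TU + 3YD² + 21 log(3) D³` for `Res_D`; here `Res_D` is replaced by `Φ` and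
`e^{h_𝓑}` by the crude bound `N!(3e^Y)^N`, exactly as in the tree's `Roy2013.prop_6_1`.)
[cite: NguyenRoy2016, Proposition 15 (proof, "h_{𝒞_D}(ℙ²(ℂ)) ≤ −TU + 3YD² + 21 log(3)D³")] -/
theorem royPhi_le_of_small_at_translates (hr : r ≠ 0) (hη : η ≠ 0) (hs : 1 < ‖s‖) {T L : ℕ}
    (hTL : T ≤ (L + 2).choose 2) (hLD : L ≤ D) {Y U : ℝ} (hU : 0 ≤ U)
    (hY : interpConst ξ η r s L ≤ Real.exp Y)
    (hM₁ : ∀ μ ∈ M₁, μ.degree = 2 * D) (hM₂ : ∀ μ ∈ M₂, μ.degree = 2 * D)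
    (σ : (↥(finsuppAntidiag (univ : Finset (Fin 3)) (2 * D)) ⊕ (↥M₁ ⊕ ↥M₂)) ≃
      ↥(finsuppAntidiag (univ : Finset (Fin 3)) (3 * D)))
    {Ps : Fin 3 → CX} (hPh : ∀ j, (Ps j).IsHomogeneous D)
    (hPn : ∀ j, maxNorm (Ps j) ≤ Real.exp Y)
    (hPv : ∀ j, ∀ i : ℕ, i < T →
      ‖MvPolynomial.eval ![1, ξ + i * r, η * s ^ i] (Ps j)‖ ≤ Real.exp (-U)) :
    ‖royPhi D M₁ M₂ σ Ps‖ ≤ Real.exp (-(T * U)) *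
      ((Fintype.card ↥(finsuppAntidiag (univ : Finset (Fin 3)) (3 * D))).factorial *
        (3 * Real.exp Y) ^ Fintype.card ↥(finsuppAntidiag (univ : Finset (Fin 3)) (3 * D))) := by
  classical
  set K : ℝ := interpConst ξ η r s L with hK
  have hM : (L + 2).choose 2 = (L + 1) * (L + 2) / 2 := choose_two_eq L
  -- Step 1: the interpolating forms `Q_j ∈ ℂ[X]_L` (Proposition 8)
  have hQ : ∀ j : Fin 3, ∃ Q : CX, Q.IsHomogeneous L ∧
      (∀ n : ℕ, n < (L + 1) * (L + 2) / 2 → MvPolynomial.eval ![1, ξ + n * r, η * s ^ n] Q =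
        if n < T then MvPolynomial.eval ![1, ξ + n * r, η * s ^ n] (Ps j) else 0) ∧
      l1Norm Q ≤ K * Real.exp (-U) := fun j =>
    exists_form_with_values hr hη hs L _ fun n _ => by
      split_ifs with h
      · exact hPv j n h
      · rw [norm_zero]; exact (Real.exp_pos _).le
  choose Q hQh hQv hQn using hQ
  set Rs : Fin 3 → CX := fun j => X 0 ^ (D - L) * Q j with hRs
  set Qs₀ : Fin 3 → CX := fun j => Ps j - Rs j with hQs₀
  have hRh : ∀ j, (Rs j).IsHomogeneous D := fun j => by
    have h := (isHomogeneous_X_pow (R := ℂ) (0 : Fin 3) (D - L)).mul (hQh j)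
    rwa [Nat.sub_add_cancel hLD] at h
  have hQs₀h : ∀ j, (Qs₀ j).IsHomogeneous D := fun j => (hPh j).sub (hRh j)
  have hQs₀v : ∀ j, Qs₀ j ∈ transVanIdeal ξ η r s T := fun j =>
    mem_transVanIdeal_iff.mpr fun i hi => by
      change MvPolynomial.eval ![1, ξ + i * r, η * s ^ i] (Ps j - X 0 ^ (D - L) * Q j) = 0
      rw [map_sub, eval_X_zero_pow_mul, hQv j i (by rw [← hM]; exact lt_of_lt_of_le hi hTL),
        if_pos hi, sub_self]
  -- Step 2: the line `z ↦ Φ(P_j − (1 − z) X₀^{D−L} Q_j)` vanishes to order `T` at `0`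
  have hT3 : T ≤ (3 * D + 2).choose 2 := hTL.trans (Nat.choose_le_choose 2 (by omega))
  obtain ⟨p, hpdvd, hpeval⟩ :=
    royPhi_line_multiplicity_translates hr hη hs hT3 hM₁ hM₂ σ hQs₀h hQs₀v Rs
  have hPs : Ps = Qs₀ + (1 : ℂ) • Rs := by
    funext j; simp [hQs₀]
  -- Step 3: size on the circle `|z| = e^U`
  have hK0 : 0 ≤ K := interpConst_nonneg L
  have hU1 : Real.exp (-U) ≤ 1 := Real.exp_le_one_iff.mpr (neg_nonpos.mpr hU)
  have hcirc : ∀ z : ℂ, ‖z‖ = Real.exp U → ‖p.eval z‖ ≤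
      (Fintype.card ↥(finsuppAntidiag (univ : Finset (Fin 3)) (3 * D))).factorial *
        (3 * Real.exp Y) ^ Fintype.card ↥(finsuppAntidiag (univ : Finset (Fin 3)) (3 * D)) := by
    intro z hz
    rw [← hpeval]
    refine norm_royPhi_le σ _ fun j => ?_
    rw [Pi.add_apply, Pi.smul_apply]
    change maxNorm (Ps j - Rs j + z • Rs j) ≤ 3 * Real.exp Y
    have hR : maxNorm (Rs j) ≤ K * Real.exp (-U) :=
      ((maxNorm_le_l1Norm _).trans (l1Norm_X_pow_mul_le 0 (D - L) (Q j))).trans (hQn j)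
    have hz1 : ‖z - 1‖ ≤ Real.exp U + 1 := by
      refine (norm_sub_le _ _).trans ?_; rw [hz, norm_one]
    calc maxNorm (Ps j - Rs j + z • Rs j) = maxNorm (Ps j + C (z - 1) * Rs j) := by
          congr 1; rw [smul_eq_C_mul, map_sub, C_1]; ring
      _ ≤ maxNorm (Ps j) + ‖z - 1‖ * maxNorm (Rs j) := by
          refine (maxNorm_add_le _ _).trans ?_; rw [maxNorm_C_mul]
      _ ≤ Real.exp Y + (Real.exp U + 1) * (K * Real.exp (-U)) :=
          add_le_add (hPn j) (mul_le_mul hz1 hR (maxNorm_nonneg _) (by positivity))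
      _ = Real.exp Y + K * (1 + Real.exp (-U)) := by
          rw [show (Real.exp U + 1) * (K * Real.exp (-U)) =
            K * (Real.exp U * Real.exp (-U) + Real.exp (-U)) by ring, ← Real.exp_add,
            add_neg_cancel, Real.exp_zero]
      _ ≤ Real.exp Y + K * 2 :=
          add_le_add le_rfl
            (mul_le_mul_of_nonneg_left (show 1 + Real.exp (-U) ≤ (2 : ℝ) by linarith) hK0)
      _ ≤ 3 * Real.exp Y := by linarith [hY]
  -- Step 4: Schwarz
  rw [hPs, hpeval]
  have h := norm_eval_one_le_of_X_pow_dvd hpdvd (Real.one_le_exp hU) fun z hz => hcirc z hz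
  refine h.trans (le_of_eq ?_)
  rw [← Real.exp_nat_mul, div_eq_mul_inv, ← Real.exp_neg, mul_comm]

end NguyenRoy

end Literature.NumberTheory.Transcendental
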